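import Literature.Computability.FineGrained.Sweep1
import Literature.Computability.Complexity.CircuitSemantics
import Literature.Computability.Complexity.CircuitRestriction
import Mathlib.Algebra.BigOperators.Ring.Finset
import Mathlib.Algebra.BigOperators.Fin
import Mathlib.Algebra.Order.BigOperators.Ring.Finset
import Mathlib.Algebra.BigOperators.GroupWithZero.Finset
import Mathlib.Data.Fintype.BigOperators
import Mathlib.Data.Fintype.Option
import Mathlib.Data.Fintype.Sum
import Mathlib.Logic.Equiv.Nat
import HarnessLib

/-!
# Equality representations of Disjointness from depth-two exact threshold circuits

First ingredient of the proof of the win-win theorem `ethr2_lower_bound_or_ov_almost_linear` of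
`Literature.Computability.FineGrained.Sweep1` (R. Williams, *The Orthogonal Vectors Conjecture and
Non-Uniform Circuit Lower Bounds*, FOCS 2024; full version ECCC TR24-142, whose theorem numbers we
use): **Theorem 2** of the paper in the prelude circuit model — a depth-two exact threshold
(`ETHR ∘ ETHR`) circuit of size `s` for the read-once 2-DNF `⋁ᵢ (xᵢ ∧ yᵢ)` on `2m` variables (the
Boolean Inner Product / Intersection function) gives a *weak equality representation* of the
`2^m × 2^m` Disjointness matrix: integers `α_ℓ` and defining vectors `u_ℓ, v_ℓ` with
`Σ_ℓ α_ℓ [u_ℓ(x) = v_ℓ(y)] = 0` exactly when `x` and `y` intersect.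

* `EqRep k r`: a linear combination of `r` equality matrices on `{0,1}^k × {0,1}^k` (coefficients
  in `ℤ`, defining vectors with values in `ℕ` below a common `bound`, cf. footnote 3 of the paper:
  the values may be recoded by any injection); `EqRep.eval` is the represented matrix entry.
* `EqRep.square`, `EqRep.eval_square`: the entrywise square is again a combination of `r²`
  equality matrices (pair the defining vectors; the sum-of-squares trick of Thm. 10 of the paper,
  applied here at block level), whence `EqRep.IsPosDisj` — a *nonnegative* combination vanishing
  exactly on intersecting pairs — from a weak representation (`EqRep.isPosDisj_square`).
* `exists_eqRep_of_hasEThr2CircuitOfSize` (**Thm. 2**): `HasEThr2CircuitOfSize m s` gives an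
  `EqRep m r` with `r ≤ s + 2m + 1` vanishing exactly on the intersecting pairs;
  `exists_isPosDisj_of_hasEThr2CircuitOfSize`: a positive one with `r ≤ (s + 2m + 1)²`.
* Kronecker powers (**Thm. 8**, "Uniformization", the distributivity computation): for `K` blocks,
  `EqRep.blockEval R X Y = ∏_{mb} R.eval (X mb) (Y mb)` equals
  `Σ_{q ∈ [r]^K} (∏ α_{q_mb}) · [∀ mb, u^{(q_mb)}(X mb) = v^{(q_mb)}(Y mb)]` (`EqRep.blockEval_eq_sum`),
  and the conjunction of the `K` equalities is one equality of base-`bound` packed keys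
  (`EqRep.key`, `EqRep.key_eq_key_iff` — "the concatenation of `u^{(q_m)}(i_m)` over all `m`").
* The pair sum of an OV instance cut into zero-padded blocks (`blockOf`, `EqRep.pairSum`):
  `S = Σ_{i,j} ∏_{mb} R.eval (a_i|mb) (b_j|mb)` is `> 0` iff there is an orthogonal pair
  (`EqRep.pairSum_pos_iff`, for a positive `R`), and equals
  `Σ_q (∏ α_{q_mb}) · #{(i,j) : key_q(a_i) = key_q(b_j)}` (`EqRep.pairSum_eq_count`) — the quantity
  the word-RAM algorithm of Thm. 10 / Thm. 3 computes by counting equal keys.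

## The proof of Theorem 2 in the model

In `Sweep1.lean` a depth-two circuit is a straight-line `Circuit` over `exactThrBasis` of `depth ≤ 2`;
its output gate may read input wires directly and may read the same wire several times. If the
output is an input wire the circuit computes a projection, which is not the read-once 2-DNF
(`m ≥ 1` as the wire exists). Otherwise the output gate `G = [Σ_a W_a · w_a = T]` reads wires `w_a`
that are inputs or — by the depth bound, `args_inl_of_depth_le_two` — gates all of whose arguments
are inputs. Every such wire is an equality test `[L_w(x) = R_w(y)]` with integer sides (paper,
proof of Thm. 2: `u[x] = Σ α_j x_j`, `v[y] = t - Σ β_j y_j`; an input wire `x_i` is `[1 - x_i = 0]`).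
Grouping the arguments of `G` by wire (one term per gate of the circuit and per input variable,
plus the constant term `-T · [0 = 0]`) gives `Σ_w (Σ_{a ↦ w} W_a) [L_w(x) = R_w(y)] - T`, which
vanishes iff `G` outputs `true` iff `x, y` intersect; the number of terms is `size + 2m + 1`.

## References

* R. Williams, *The Orthogonal Vectors Conjecture and Non-Uniform Circuit Lower Bounds*,
  FOCS 2024, 1372–1387; full version ECCC TR24-142 (2024), §1 (equality matrices, weak equality
  rank), §2 Thm. 2 (circuits to rank), §3 Thm. 10 (sum of squares).
* K. A. Hansen, V. V. Podolskii, *Exact threshold circuits*, CCC 2010, §2 (`ETHR` gates).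
-/

namespace Literature.Computability.FineGrained

open Finset Complexity Cryptography

/-! ### Equality representations -/

/-- A linear combination of `r` *equality matrices* on `{0,1}^k × {0,1}^k`: term `ℓ` is the
`2^k × 2^k` 0-1 matrix `[left ℓ x = right ℓ y]` with integer coefficient `coef ℓ`; the defining
vectors take natural values below `bound` (Williams, ECCC TR24-142, §1, "equality matrix",
"equality rank", footnote 3). [cite: Williams2024, §1] -/
structure EqRep (k r : ℕ) where
  /-- The coefficients `α_ℓ`. -/
  coef : Fin r → ℤ
  /-- The defining vectors `u^{(ℓ)}` of the rows. -/
  left : Fin r → (Fin k → Bool) → ℕ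
  /-- The defining vectors `v^{(ℓ)}` of the columns. -/
  right : Fin r → (Fin k → Bool) → ℕ
  /-- A strict bound on all values of the defining vectors. -/
  bound : ℕ
  /-- Row values are below the bound. -/
  left_lt : ∀ ℓ x, left ℓ x < bound
  /-- Column values are below the bound. -/
  right_lt : ∀ ℓ y, right ℓ y < bound

namespace EqRep

variable {k r : ℕ}

/-- The `(x, y)` entry of the represented matrix `Σ_ℓ α_ℓ M_ℓ` (Williams, ECCC TR24-142, §1). [cite: Williams2024, §1] -/
def eval (R : EqRep k r) (x y : Fin k → Bool) : ℤ :=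
  ∑ ℓ, if R.left ℓ x = R.right ℓ y then R.coef ℓ else 0

/-- Integer-valued defining vectors on a finite index type give an `EqRep` with the same entries
(values recoded into `ℕ` by an injection; Williams, ECCC TR24-142, §1, footnote 3). [cite: Williams2024, §1 footnote 3] -/
theorem exists_of_int {I : Type*} [Fintype I] (c : I → ℤ) (L R : I → (Fin k → Bool) → ℤ) :
    ∃ E : EqRep k (Fintype.card I), ∀ x y,
      E.eval x y = ∑ i, if L i x = R i y then c i else 0 := by
  classical
  set e := Fintype.equivFin I with he
  set f : ℤ → ℕ := fun z => Equiv.intEquivNat z with hf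
  have hfi : Function.Injective f := Equiv.intEquivNat.injective
  set B : ℕ := (univ.sup fun p : Fin (Fintype.card I) × (Fin k → Bool) => f (L (e.symm p.1) p.2)) ⊔
    (univ.sup fun p : Fin (Fintype.card I) × (Fin k → Bool) => f (R (e.symm p.1) p.2)) + 1 with hB
  refine ⟨⟨fun ℓ => c (e.symm ℓ), fun ℓ x => f (L (e.symm ℓ) x), fun ℓ y => f (R (e.symm ℓ) y), B,
    fun ℓ x => ?_, fun ℓ y => ?_⟩, fun x y => ?_⟩
  · have : f (L (e.symm ℓ) x) ≤ univ.sup fun p : Fin (Fintype.card I) × (Fin k → Bool) =>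
        f (L (e.symm p.1) p.2) := le_sup (f := fun p : Fin (Fintype.card I) × (Fin k → Bool) =>
        f (L (e.symm p.1) p.2)) (mem_univ (ℓ, x))
    rw [hB]; omega
  · have : f (R (e.symm ℓ) y) ≤ univ.sup fun p : Fin (Fintype.card I) × (Fin k → Bool) =>
        f (R (e.symm p.1) p.2) := le_sup (f := fun p : Fin (Fintype.card I) × (Fin k → Bool) =>
        f (R (e.symm p.1) p.2)) (mem_univ (ℓ, y))
    rw [hB]; omega
  · unfold eval
    simp only [hfi.eq_iff]
    exact e.symm.sum_comp (fun i => if L i x = R i y then c i else 0)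

/-- **The square of a representation** (Williams, ECCC TR24-142, proof of Thm. 10: expand
`(Σ_k α_k E_k[i,j])²` into `r²` equality matrices with paired defining vectors
`U^{(k,k')}[i] = (u^{(k)}[i], u^{(k')}[i])`); pairs are packed in base `bound`. [cite: Williams2024, Thm. 10 (proof)] -/
def square (R : EqRep k r) : EqRep k (r * r) where
  coef p := R.coef (finProdFinEquiv.symm p).1 * R.coef (finProdFinEquiv.symm p).2
  left p x := R.left (finProdFinEquiv.symm p).1 x * R.bound + R.left (finProdFinEquiv.symm p).2 x
  right p y := R.right (finProdFinEquiv.symm p).1 y * R.bound + R.right (finProdFinEquiv.symm p).2 y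
  bound := R.bound * R.bound
  left_lt p x := by
    have h1 := R.left_lt (finProdFinEquiv.symm p).1 x
    have h2 := R.left_lt (finProdFinEquiv.symm p).2 x
    calc _ < R.left (finProdFinEquiv.symm p).1 x * R.bound + R.bound := by omega
      _ = (R.left (finProdFinEquiv.symm p).1 x + 1) * R.bound := by ring
      _ ≤ R.bound * R.bound := Nat.mul_le_mul_right _ h1
  right_lt p y := by
    have h1 := R.right_lt (finProdFinEquiv.symm p).1 y
    have h2 := R.right_lt (finProdFinEquiv.symm p).2 y
    calc _ < R.right (finProdFinEquiv.symm p).1 y * R.bound + R.bound := by omega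
      _ = (R.right (finProdFinEquiv.symm p).1 y + 1) * R.bound := by ring
      _ ≤ R.bound * R.bound := Nat.mul_le_mul_right _ h1

/-- Base-`B` pairing of numbers below `B` is injective. [folklore] -/
theorem pair_eq_pair_iff {a b a' b' B : ℕ} (hb : b < B) (hb' : b' < B) :
    a * B + b = a' * B + b' ↔ a = a' ∧ b = b' := by
  refine ⟨fun h => ?_, fun h => by rw [h.1, h.2]⟩
  have hB : 0 < B := by omega
  have h1 : (a * B + b) / B = a := by
    rw [Nat.add_comm, Nat.add_mul_div_right _ _ hB, Nat.div_eq_of_lt hb, Nat.zero_add]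
  have h2 : (a' * B + b') / B = a' := by
    rw [Nat.add_comm, Nat.add_mul_div_right _ _ hB, Nat.div_eq_of_lt hb', Nat.zero_add]
  have ha : a = a' := by rw [← h1, ← h2, h]
  subst ha
  exact ⟨rfl, by omega⟩

/-- The square represents the entrywise square: `R.square.eval x y = (R.eval x y)²`
(Williams, ECCC TR24-142, proof of Thm. 10). [cite: Williams2024, Thm. 10 (proof)] -/
theorem eval_square (R : EqRep k r) (x y : Fin k → Bool) :
    R.square.eval x y = R.eval x y ^ 2 := by
  unfold eval square
  simp only
  rw [sq, Finset.sum_mul_sum, ← Finset.sum_product', ← finProdFinEquiv.sum_comp]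
  simp only [Equiv.symm_apply_apply, Fintype.sum_prod_type, univ_product_univ]
  refine Finset.sum_congr rfl fun i _ => Finset.sum_congr rfl fun j _ => ?_
  simp only [pair_eq_pair_iff (R.left_lt j x) (R.right_lt j y)]
  by_cases hi : R.left i x = R.right i y <;> by_cases hj : R.left j x = R.right j y <;> simp [hi, hj]

/-- A *positive representation of Disjointness*: the represented matrix is entrywise nonnegative
and vanishes exactly on the intersecting (non-orthogonal) pairs — the shape `(Σ_k α_k E_k)²` of a
weak equality representation of `DISJ` (Williams, ECCC TR24-142, §1 "weak equality rank" and
proof of Thm. 10). [cite: Williams2024, §1 and Thm. 10 (proof)] -/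
structure IsPosDisj (R : EqRep k r) : Prop where
  /-- Entries are nonnegative. -/
  nonneg : ∀ x y, 0 ≤ R.eval x y
  /-- Entries vanish exactly on intersecting pairs. -/
  eq_zero_iff : ∀ x y, R.eval x y = 0 ↔ ¬ AreOrthogonal x y

/-- A positive representation is positive exactly on the orthogonal (disjoint) pairs. [cite: Williams2024, Thm. 10 (proof)] -/
theorem IsPosDisj.pos_iff {R : EqRep k r} (h : R.IsPosDisj) (x y : Fin k → Bool) :
    0 < R.eval x y ↔ AreOrthogonal x y := by
  rw [(h.nonneg x y).lt_iff_ne', ne_eq, h.eq_zero_iff, not_not]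

/-- **Sum of squares** (Williams, ECCC TR24-142, proof of Thm. 10): the square of a weak equality
representation of Disjointness is a positive representation. [cite: Williams2024, Thm. 10 (proof)] -/
theorem isPosDisj_square {R : EqRep k r} (h : ∀ x y, R.eval x y = 0 ↔ ¬ AreOrthogonal x y) :
    R.square.IsPosDisj where
  nonneg x y := by rw [eval_square]; positivity
  eq_zero_iff x y := by rw [eval_square, sq_eq_zero_iff, h]

end EqRep

/-! ### The two halves of the input of the read-once 2-DNF -/

section halves

variable {m : ℕ}

/-- Glue two `m`-bit halves `x, y` into an input of the read-once 2-DNF on the `2m` variables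
`(0, i) ↦ xᵢ`, `(1, i) ↦ yᵢ` (the row/column indexing of the matrix `M_f(x, y) = f(xy)` of
Williams, ECCC TR24-142, Thm. 2). [cite: Williams2024, Thm. 2] -/
def twoHalves (x y : Fin m → Bool) : Fin 2 × Fin m → Bool :=
  fun p => if p.1 = 0 then x p.2 else y p.2

/-- The first half. [folklore] -/
@[simp] theorem twoHalves_zero (x y : Fin m → Bool) (i : Fin m) : twoHalves x y (0, i) = x i := rfl

/-- The second half. [folklore] -/
@[simp] theorem twoHalves_one (x y : Fin m → Bool) (i : Fin m) : twoHalves x y (1, i) = y i := by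
  simp [twoHalves]

/-- Two Boolean vectors are not orthogonal iff they share a `true` coordinate. [folklore] -/
theorem not_areOrthogonal_iff (x y : Fin m → Bool) :
    ¬ AreOrthogonal x y ↔ ∃ i, x i = true ∧ y i = true := by
  simp [AreOrthogonal]

/-- The read-once 2-DNF on the glued input is the Intersection (non-orthogonality) indicator
(Williams, ECCC TR24-142, §1: `DISJ` is the complement of Boolean Inner Product). [cite: Williams2024, §1] -/
theorem readOnceTwoDNF_twoHalves (x y : Fin m → Bool) :
    readOnceTwoDNF m (twoHalves x y) = decide (¬ AreOrthogonal x y) := by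
  simp only [readOnceTwoDNF, twoHalves_zero, twoHalves_one, not_areOrthogonal_iff]

/-- Row part of the contribution `[wire] · c` of an input wire with weight `c` to an exact
threshold sum: `α_j x_j` (Williams, ECCC TR24-142, proof of Thm. 2). [cite: Williams2024, Thm. 2 (proof)] -/
def lterm (x : Fin m → Bool) : (Fin 2 × Fin m) ⊕ ℕ → ℤ → ℤ
  | .inl p, c => if p.1 = 0 then (if x p.2 then c else 0) else 0
  | .inr _, _ => 0

/-- Column part of the contribution of an input wire with weight `c`: `β_j y_j`
(Williams, ECCC TR24-142, proof of Thm. 2). [cite: Williams2024, Thm. 2 (proof)] -/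
def rterm (y : Fin m → Bool) : (Fin 2 × Fin m) ⊕ ℕ → ℤ → ℤ
  | .inl p, c => if p.1 = 0 then 0 else (if y p.2 then c else 0)
  | .inr _, _ => 0

/-- Row and column parts add up to the contribution of the wire. [cite: Williams2024, Thm. 2 (proof)] -/
theorem lterm_add_rterm (x y : Fin m → Bool) (p : Fin 2 × Fin m) (c : ℤ) :
    lterm x (.inl p) c + rterm y (.inl p) c = if twoHalves x y p = true then c else 0 := by
  obtain ⟨s, i⟩ := p
  simp only [lterm, rterm, twoHalves]
  by_cases hs : s = 0 <;> simp [hs]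

/-- Row side of an input wire read directly by the output gate, as an equality test:
`xᵢ = [1 - xᵢ = 0]`, `yᵢ = [0 = 1 - yᵢ]`. [folklore] -/
def linp (x : Fin m → Bool) (p : Fin 2 × Fin m) : ℤ := if p.1 = 0 then (if x p.2 then 0 else 1) else 0

/-- Column side of an input wire read directly by the output gate. [folklore] -/
def rinp (y : Fin m → Bool) (p : Fin 2 × Fin m) : ℤ := if p.1 = 0 then 0 else (if y p.2 then 0 else 1)

/-- An input wire is the equality test `[linp = rinp]`. [folklore] -/
theorem linp_eq_rinp_iff (x y : Fin m → Bool) (p : Fin 2 × Fin m) :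
    linp x p = rinp y p ↔ twoHalves x y p = true := by
  obtain ⟨s, i⟩ := p
  simp only [linp, rinp, twoHalves]
  by_cases hs : s = 0 <;> simp [hs]

end halves

/-- Pushing an `if` over a sum. [folklore] -/
theorem ite_sum_zero {α : Type*} (s : Finset α) (P : Prop) [Decidable P] (f : α → ℤ) :
    (if P then ∑ a ∈ s, f a else 0) = ∑ a ∈ s, if P then f a else 0 := by
  split_ifs <;> simp

/-! ### Depth in straight-line programs -/

section depth

variable {ι : Type*}

/-- The depth of gate `j` of a well-formed program, read off the full depth list: its weight plus
the maximal depth of its argument wires (Vollmer 1999, §1.2). [folklore] -/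
theorem getD_wdepths_of_lt (w : GateFn → ℕ) (gs : List (Gate ι)) {j : ℕ} (hj : j < gs.length)
    (hok : GateList.GateOK j gs[j]) :
    (GateList.wdepths w gs).getD j 0 =
      w gs[j].fn + univ.sup fun a => GateList.wireDepthOf (GateList.wdepths w gs) (gs[j].args a) := by
  have hsplit : gs = (gs.take j ++ [gs[j]]) ++ gs.drop (j + 1) := by
    rw [List.append_assoc, List.singleton_append, ← List.drop_eq_getElem_cons hj,
      List.take_append_drop]
  have hlen : (gs.take j).length = j := by simp; omega
  obtain ⟨ws, hws⟩ := GateList.wdepths_append_take w (gs.take j ++ [gs[j]]) (gs.drop (j + 1))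
  rw [← hsplit] at hws
  have hA : (GateList.wdepths w (gs.take j ++ [gs[j]])).length = j + 1 := by simp; omega
  have h1 : (GateList.wdepths w gs).getD j 0 =
      (GateList.wdepths w (gs.take j ++ [gs[j]])).getD j 0 := by
    rw [hws, List.getD_append _ _ _ _ (by rw [hA]; omega)]
  have h2 := GateList.getD_wdepths_append_singleton w (gs.take j) gs[j]
  rw [hlen] at h2
  rw [h1, h2]
  congr 1
  refine Finset.sup_congr rfl fun a _ => ?_
  have hu : GateList.OutOK (gs.take j).length (gs[j].args a) := by
    rw [hlen]; exact fun m hm => hok a m hm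
  rw [← GateList.wireDepthOf_wdepths_append w (gs.take j) (gs.drop j) _ hu, List.take_append_drop]

/-- Every gate has (unit-weight) depth at least `1`. [folklore] -/
theorem one_le_getD_wdepths (gs : List (Gate ι)) {j : ℕ} (hj : j < gs.length) :
    1 ≤ (GateList.wdepths (fun _ => 1) gs).getD j 0 := by
  have hsplit : gs = (gs.take j ++ [gs[j]]) ++ gs.drop (j + 1) := by
    rw [List.append_assoc, List.singleton_append, ← List.drop_eq_getElem_cons hj,
      List.take_append_drop]
  have hlen : (gs.take j).length = j := by simp; omega
  obtain ⟨ws, hws⟩ := GateList.wdepths_append_take (fun _ => 1) (gs.take j ++ [gs[j]])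
    (gs.drop (j + 1))
  rw [← hsplit] at hws
  have hA : (GateList.wdepths (fun _ => 1) (gs.take j ++ [gs[j]])).length = j + 1 := by
    simp; omega
  have h2 := GateList.getD_wdepths_append_singleton (fun _ => 1) (gs.take j) gs[j]
  rw [hlen] at h2
  rw [hws, List.getD_append _ _ _ _ (by rw [hA]; omega), h2]
  exact Nat.le_add_right _ _

/-- **Structure of depth-two circuits.** If the output of a circuit of depth `≤ 2` is the gate
`g`, then every *gate* argument of `g` is a gate all of whose arguments are input wires (the
"bottom layer" of an `ETHR ∘ ETHR` circuit, Williams, ECCC TR24-142, §1). [folklore] -/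
theorem args_inl_of_depth_le_two (C : Circuit ι) {g : ℕ} (hout : C.output = .inr g)
    (hdepth : C.depth ≤ 2) {a : Fin (C.gates[g]'(C.wf_output g hout)).arity} {m : ℕ}
    (ha : (C.gates[g]'(C.wf_output g hout)).args a = .inr m) :
    ∃ hm : m < C.gates.length, ∀ b : Fin (C.gates[m]'hm).arity, ∃ i, (C.gates[m]'hm).args b = .inl i := by
  have hg : g < C.gates.length := C.wf_output g hout
  have hmg : m < g := C.wf g hg a m ha
  have hm : m < C.gates.length := hmg.trans hg
  refine ⟨hm, fun b => ?_⟩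
  have hD : (GateList.wdepths (fun _ => 1) C.gates).getD g 0 ≤ 2 := by
    have := hdepth
    unfold Circuit.depth at this
    rwa [GateList.circuit_depthWith, hout] at this
  rw [getD_wdepths_of_lt (fun _ => 1) C.gates hg (fun a m h => C.wf g hg a m h)] at hD
  have hsup : (univ.sup fun a => GateList.wireDepthOf (GateList.wdepths (fun _ => 1) C.gates)
      ((C.gates[g]'hg).args a)) ≤ 1 := by omega
  have ha1 := (Finset.sup_le_iff.1 hsup) a (mem_univ a)
  rw [ha, GateList.wireDepthOf_inr,
    getD_wdepths_of_lt (fun _ => 1) C.gates hm (fun b m' h => C.wf m hm b m' h)] at ha1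
  have hsup0 : (univ.sup fun b => GateList.wireDepthOf (GateList.wdepths (fun _ => 1) C.gates)
      ((C.gates[m]'hm).args b)) = 0 := by omega
  have hb0 := (Finset.sup_eq_bot_iff _ _).1 hsup0 b (mem_univ b)
  cases hb : (C.gates[m]'hm).args b with
  | inl i => exact ⟨i, rfl⟩
  | inr m' =>
    exfalso
    rw [hb, GateList.wireDepthOf_inr] at hb0
    have hm' : m' < C.gates.length := (C.wf m hm b m' hb).trans hm
    have := one_le_getD_wdepths C.gates hm'
    simp only [bot_eq_zero'] at hb0
    omega

end depth

/-! ### Exact threshold gates -/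

section ethr

variable {ι : Type*}

/-- The truth table of a gate from the basis `ETHR`: `[Σᵢ wᵢ vᵢ = t]` for some integer weights
and threshold (Hansen–Podolskii, CCC 2010, §2). [cite: CCC2010, §2] -/
theorem exists_op_eq_of_mem_exactThrBasis {g : Gate ι} (hg : g.fn ∈ exactThrBasis) :
    ∃ (w : Fin g.arity → ℤ) (t : ℤ), ∀ v, g.op v = decide ((∑ i, if v i then w i else 0) = t) := by
  obtain ⟨k, w, t, h⟩ := hg
  unfold Gate.fn exactThrGate at h
  obtain ⟨rfl, h2⟩ := Sigma.mk.inj_iff.mp h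
  exact ⟨w, t, fun v => by rw [eq_of_heq h2]⟩

end ethr

/-! ### Theorem 2: from a depth-two exact threshold circuit to a representation -/

section extraction

variable {m : ℕ}

/-- Every gate of a circuit over `ETHR` is an exact threshold gate. [cite: CCC2010, §2] -/
private theorem gate_ethr (C : Circuit (Fin 2 × Fin m)) (hover : C.IsOver exactThrBasis)
    (j : ℕ) (hj : j < C.gates.length) :
    ∃ (w : Fin (C.gates[j]).arity → ℤ) (t : ℤ),
      ∀ v : Fin (C.gates[j]).arity → Bool,
        (C.gates[j]).op v = decide ((∑ i, if v i then w i else 0) = t) :=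
  exists_op_eq_of_mem_exactThrBasis (hover _ (List.getElem_mem hj))

/-- The integer weights of gate `j` of a circuit over `ETHR` (a choice). [folklore] -/
private noncomputable def gw (C : Circuit (Fin 2 × Fin m)) (hover : C.IsOver exactThrBasis)
    (j : ℕ) (hj : j < C.gates.length) : Fin (C.gates[j]).arity → ℤ :=
  (gate_ethr C hover j hj).choose

/-- The threshold of gate `j` of a circuit over `ETHR` (a choice). [folklore] -/
private noncomputable def gt (C : Circuit (Fin 2 × Fin m)) (hover : C.IsOver exactThrBasis)
    (j : ℕ) (hj : j < C.gates.length) : ℤ :=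
  (gate_ethr C hover j hj).choose_spec.choose

/-- Gate `j` is `[Σᵢ (gw i) vᵢ = gt]`. [folklore] -/
private theorem gop (C : Circuit (Fin 2 × Fin m)) (hover : C.IsOver exactThrBasis)
    (j : ℕ) (hj : j < C.gates.length) (v : Fin (C.gates[j]).arity → Bool) :
    (C.gates[j]).op v = decide ((∑ i, if v i then gw C hover j hj i else 0) = gt C hover j hj) :=
  (gate_ethr C hover j hj).choose_spec.choose_spec v

/-- The row side `u[x]` of a wire as an equality test: `Σ_j α_j x_j` for a bottom gate
(Williams, ECCC TR24-142, proof of Thm. 2), `linp` for an input wire. [cite: Williams2024, Thm. 2 (proof)] -/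
private noncomputable def Lf (C : Circuit (Fin 2 × Fin m)) (hover : C.IsOver exactThrBasis) :
    (Fin 2 × Fin m) ⊕ ℕ → (Fin m → Bool) → ℤ
  | .inl p, x => linp x p
  | .inr j, x => if hj : j < C.gates.length then
      ∑ b, lterm x ((C.gates[j]).args b) (gw C hover j hj b) else 0

/-- The column side `v[y]` of a wire as an equality test: `t - Σ_j β_j y_j` for a bottom gate
(Williams, ECCC TR24-142, proof of Thm. 2), `rinp` for an input wire. [cite: Williams2024, Thm. 2 (proof)] -/
private noncomputable def Rf (C : Circuit (Fin 2 × Fin m)) (hover : C.IsOver exactThrBasis) :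
    (Fin 2 × Fin m) ⊕ ℕ → (Fin m → Bool) → ℤ
  | .inl p, y => rinp y p
  | .inr j, y => if hj : j < C.gates.length then
      gt C hover j hj - ∑ b, rterm y ((C.gates[j]).args b) (gw C hover j hj b) else 0

/-- A bottom gate (all arguments are inputs) is the equality test `[u[x] = v[y]]`
(Williams, ECCC TR24-142, proof of Thm. 2: "the matrix `M_{g_i}` is an equality matrix"). [cite: Williams2024, Thm. 2 (proof)] -/
private theorem getD_transcript_of_inputs (C : Circuit (Fin 2 × Fin m))
    (hover : C.IsOver exactThrBasis) (j : ℕ) (hj : j < C.gates.length)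
    (hinl : ∀ b : Fin (C.gates[j]).arity, ∃ i, (C.gates[j]).args b = .inl i) (x y : Fin m → Bool) :
    (transcript (twoHalves x y) [] C.gates).getD j false =
      decide (Lf C hover (.inr j) x = Rf C hover (.inr j) y) := by
  rw [getD_transcript_eq_gateValue C _ j hj, gateValue, gop C hover j hj]
  simp only [Lf, Rf, dif_pos hj]
  have hterm : ∀ b : Fin (C.gates[j]).arity,
      (if wireVal (twoHalves x y) (transcript (twoHalves x y) [] C.gates) ((C.gates[j]).args b) = true
        then gw C hover j hj b else 0) =
      lterm x ((C.gates[j]).args b) (gw C hover j hj b) +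
        rterm y ((C.gates[j]).args b) (gw C hover j hj b) := by
    intro b
    obtain ⟨p, hp⟩ := hinl b
    rw [hp, lterm_add_rterm]
    rfl
  simp only [hterm, Finset.sum_add_distrib]
  by_cases h : ∑ b, lterm x ((C.gates[j]).args b) (gw C hover j hj b) +
      ∑ b, rterm y ((C.gates[j]).args b) (gw C hover j hj b) = gt C hover j hj
  · rw [decide_eq_true h, decide_eq_true (by linarith)]
  · rw [decide_eq_false h, decide_eq_false (by intro h'; apply h; linarith)]

/-- Every argument wire of the output gate of a depth-two `ETHR` circuit is an equality test
`[u[x] = v[y]]`. [cite: Williams2024, Thm. 2 (proof)] -/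
private theorem wireVal_arg (C : Circuit (Fin 2 × Fin m)) (hover : C.IsOver exactThrBasis)
    {g : ℕ} (hout : C.output = .inr g) (hdepth : C.depth ≤ 2)
    (a : Fin (C.gates[g]'(C.wf_output g hout)).arity) (x y : Fin m → Bool) :
    wireVal (twoHalves x y) (transcript (twoHalves x y) [] C.gates)
        ((C.gates[g]'(C.wf_output g hout)).args a) =
      decide (Lf C hover ((C.gates[g]'(C.wf_output g hout)).args a) x =
        Rf C hover ((C.gates[g]'(C.wf_output g hout)).args a) y) := by
  cases ha : (C.gates[g]'(C.wf_output g hout)).args a with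
  | inl p =>
    simp only [wireVal, Lf, Rf]
    by_cases h : twoHalves x y p = true
    · rw [h, eq_comm, decide_eq_true_iff, linp_eq_rinp_iff]; exact h
    · rw [Bool.eq_false_iff.mpr h, eq_comm, decide_eq_false_iff_not, linp_eq_rinp_iff]; exact h
  | inr j =>
    obtain ⟨hj, hinl⟩ := args_inl_of_depth_le_two C hout hdepth ha
    simp only [wireVal]
    exact getD_transcript_of_inputs C hover j hj hinl x y

/-- The output of a depth-two `ETHR` circuit with output gate `[Σ_a γ_a g_a = t']` is the exact
threshold test `[Σ_a γ_a [u_a[x] = v_a[y]] = t']` over equality tests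
(Williams, ECCC TR24-142, proof of Thm. 2). [cite: Williams2024, Thm. 2 (proof)] -/
private theorem eval_twoHalves (C : Circuit (Fin 2 × Fin m)) (hover : C.IsOver exactThrBasis)
    {g : ℕ} (hout : C.output = .inr g) (hdepth : C.depth ≤ 2) (x y : Fin m → Bool) :
    C.eval (twoHalves x y) = decide ((∑ a : Fin (C.gates[g]'(C.wf_output g hout)).arity,
      if Lf C hover ((C.gates[g]'(C.wf_output g hout)).args a) x =
          Rf C hover ((C.gates[g]'(C.wf_output g hout)).args a) y
        then gw C hover g (C.wf_output g hout) a else 0) = gt C hover g (C.wf_output g hout)) := by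
  rw [eval_eq_wireVal, hout, wireVal, getD_transcript_eq_gateValue C _ g (C.wf_output g hout),
    gateValue, gop C hover g (C.wf_output g hout)]
  congr 1
  simp only [wireVal_arg C hover hout hdepth, decide_eq_true_eq]

/-- The wires a gate of an `L`-gate circuit on `2m` inputs may read — the `2m` input wires and the
`L` gates — embedded into all wires. [folklore] -/
private def toWire (m len : ℕ) : (Fin 2 × Fin m) ⊕ Fin len → (Fin 2 × Fin m) ⊕ ℕ :=
  Sum.map id Fin.val

/-- `toWire` is injective. [folklore] -/
private theorem toWire_injective (m len : ℕ) : Function.Injective (toWire m len) :=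
  Sum.map_injective.mpr ⟨Function.injective_id, Fin.val_injective⟩

/-- **Theorem 2 of Williams (ECCC TR24-142) in the prelude circuit model, first bullet.** If the
read-once 2-DNF `⋁_{i<m} (xᵢ ∧ yᵢ)` on `2m` variables has a depth-two exact threshold circuit with
at most `s` gates (`HasEThr2CircuitOfSize m s`), then the `2^m × 2^m` Disjointness matrix has a weak
equality representation with at most `s + 2m + 1` terms: a combination of equality matrices
vanishing exactly on the intersecting pairs. (The paper's bound `s + 1` counts one term per bottom
gate; in the prelude model the output gate may also read the `2m` input wires directly, each of
which is one more equality matrix.) [cite: Williams2024, Thm. 2] -/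
theorem exists_eqRep_of_hasEThr2CircuitOfSize {s : ℝ} (h : HasEThr2CircuitOfSize m s) :
    ∃ (r : ℕ) (R : EqRep m r), (r : ℝ) ≤ s + 2 * m + 1 ∧
      ∀ x y, R.eval x y = 0 ↔ ¬ AreOrthogonal x y := by
  obtain ⟨C, ⟨hover, hdepth⟩, hsize, hcomp⟩ := h
  cases hout : C.output with
  | inl p =>
    -- the circuit computes the projection `z ↦ z p`, which is not the read-once 2-DNF
    exfalso
    have h1 := hcomp (Function.update (fun _ => false) p true)
    unfold Circuit.eval at h1
    rw [hout] at h1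
    simp only [Function.update_self, readOnceTwoDNF] at h1
    rcases (decide_eq_true_iff.mp h1.symm) with ⟨i, h0, h1'⟩
    have e0 : ((0 : Fin 2), i) = p := by
      by_contra hne; rw [Function.update_of_ne hne] at h0; exact Bool.false_ne_true h0
    have e1 : ((1 : Fin 2), i) = p := by
      by_contra hne; rw [Function.update_of_ne hne] at h1'; exact Bool.false_ne_true h1'
    have := e0.trans e1.symm
    simp at this
  | inr g =>
    have hg : g < C.gates.length := C.wf_output g hout
    set G := C.gates[g]'(C.wf_output g hout) with hG
    set W := gw C hover g (C.wf_output g hout) with hW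
    set T := gt C hover g (C.wf_output g hout) with hT
    -- index type of the representation: the constant term and one term per wire
    let J := Option ((Fin 2 × Fin m) ⊕ Fin C.gates.length)
    let c : J → ℤ := fun o => o.elim (-T) fun ω =>
      ∑ a, if G.args a = toWire m C.gates.length ω then W a else 0
    let L : J → (Fin m → Bool) → ℤ := fun o x => o.elim 0 fun ω => Lf C hover (toWire m C.gates.length ω) x
    let Rt : J → (Fin m → Bool) → ℤ := fun o y => o.elim 0 fun ω => Rf C hover (toWire m C.gates.length ω) y
    obtain ⟨E, hE⟩ := EqRep.exists_of_int c L Rt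
    refine ⟨_, E, ?_, fun x y => ?_⟩
    · have hcard : Fintype.card J = C.size + 2 * m + 1 := by
        simp only [J, Fintype.card_option, Fintype.card_sum, Fintype.card_prod, Fintype.card_fin,
          Circuit.size]
        ring
      rw [hcard]
      push_cast
      linarith
    · rw [hE]
      -- the fibre sum over wires: grouping the arguments of `G` by the wire they read
      have hfib : ∀ a : Fin G.arity,
          ∑ ω, (if Lf C hover (toWire m C.gates.length ω) x = Rf C hover (toWire m C.gates.length ω) y then
            (if G.args a = toWire m C.gates.length ω then W a else 0) else 0) =
          if Lf C hover (G.args a) x = Rf C hover (G.args a) y then W a else 0 := by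
        intro a
        obtain ⟨ω₀, hω₀⟩ : ∃ ω₀, toWire m C.gates.length ω₀ = G.args a := by
          cases ha : G.args a with
          | inl p => exact ⟨Sum.inl p, rfl⟩
          | inr j => exact ⟨Sum.inr ⟨j, (C.wf g hg a j ha).trans hg⟩, rfl⟩
        rw [Finset.sum_eq_single ω₀]
        · rw [hω₀, if_pos rfl]
        · intro b _ hb
          have hne : G.args a ≠ toWire m C.gates.length b := fun h =>
            hb (toWire_injective m _ (h.symm.trans hω₀.symm))
          simp [hne]
        · intro h; exact absurd (mem_univ ω₀) h
      have key : ∑ o : J, (if L o x = Rt o y then c o else 0) =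
          (∑ a : Fin G.arity, if Lf C hover (G.args a) x = Rf C hover (G.args a) y then W a else 0)
            - T := by
        rw [Fintype.sum_option]
        simp only [J, c, L, Rt, Option.elim, if_true]
        simp only [ite_sum_zero]
        rw [Finset.sum_comm]
        simp only [hfib]
        ring
      rw [key, sub_eq_zero]
      have h1 := hcomp (twoHalves x y)
      rw [eval_twoHalves C hover hout hdepth, readOnceTwoDNF_twoHalves] at h1
      simp only [← hW, ← hT] at h1
      by_cases hxy : AreOrthogonal x y
      · simp only [hxy, not_true_eq_false, decide_false, decide_eq_false_iff_not] at h1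
        simpa [hxy] using h1
      · simp only [hxy, not_false_eq_true, decide_true, decide_eq_true_eq] at h1
        simpa [hxy] using h1

/-- **Positive representation from a depth-two circuit** (Williams, ECCC TR24-142, Thm. 2 combined
with the sum-of-squares step of the proof of Thm. 10): `HasEThr2CircuitOfSize m s` yields a positive
representation of `2^m × 2^m` Disjointness with at most `(s + 2m + 1)²` terms. [cite: Williams2024, Thm. 2 and Thm. 10 (proof)] -/
theorem exists_isPosDisj_of_hasEThr2CircuitOfSize {s : ℝ} (h : HasEThr2CircuitOfSize m s) :
    ∃ (r : ℕ) (R : EqRep m r), (r : ℝ) ≤ (s + 2 * m + 1) ^ 2 ∧ R.IsPosDisj := by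
  obtain ⟨r, R, hr, hR⟩ := exists_eqRep_of_hasEThr2CircuitOfSize h
  refine ⟨r * r, R.square, ?_, EqRep.isPosDisj_square hR⟩
  have h0 : (0 : ℝ) ≤ r := Nat.cast_nonneg r
  push_cast
  nlinarith

end extraction

/-! ### Kronecker powers (Theorem 8) and the pair sum (Theorems 10 and 3) -/

namespace EqRep

variable {k r : ℕ}

section blocks

variable (R : EqRep k r) {K : ℕ}

/-- The product of the represented entries over `K` blocks: the `(X, Y)` entry of the `K`-th
Kronecker power `(Σ_ℓ α_ℓ M_ℓ)^{⊗ K}` (Williams, ECCC TR24-142, proof of Thm. 8). [cite: Williams2024, Thm. 8 (proof)] -/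
def blockEval (X Y : Fin K → Fin k → Bool) : ℤ := ∏ mb, R.eval (X mb) (Y mb)

/-- Kronecker powers of a positive representation are nonnegative. [cite: Williams2024, Thm. 8 (proof)] -/
theorem blockEval_nonneg (hR : R.IsPosDisj) (X Y : Fin K → Fin k → Bool) :
    0 ≤ R.blockEval X Y :=
  Finset.prod_nonneg fun _ _ => hR.nonneg _ _

/-- The Kronecker power of a positive representation is positive exactly when every block pair is
orthogonal ("if any one of the parts is not disjoint then the product is `0`", Williams,
ECCC TR24-142, proof of Thm. 8). [cite: Williams2024, Thm. 8 (proof)] -/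
theorem blockEval_pos_iff (hR : R.IsPosDisj) (X Y : Fin K → Fin k → Bool) :
    0 < R.blockEval X Y ↔ ∀ mb, AreOrthogonal (X mb) (Y mb) := by
  unfold blockEval
  refine ⟨fun h mb => ?_, fun h => Finset.prod_pos fun mb _ => (hR.pos_iff _ _).2 (h mb)⟩
  by_contra hmb
  have h0 : ∏ mb, R.eval (X mb) (Y mb) = 0 :=
    Finset.prod_eq_zero (mem_univ mb) ((hR.eq_zero_iff _ _).2 hmb)
  omega

/-- The coefficient `∏_{mb} α_{q_mb}` of the term indexed by `q ∈ [r]^K` in the Kronecker power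
(Williams, ECCC TR24-142, proof of Thm. 8). [cite: Williams2024, Thm. 8 (proof)] -/
def coefProd (q : Fin K → Fin r) : ℤ := ∏ mb, R.coef (q mb)

/-- **Distributivity (Williams, ECCC TR24-142, proof of Thm. 8)**: the Kronecker power is the
combination, over `q ∈ [r]^K`, of the equality matrices
`[∀ mb, u^{(q_mb)}(X mb) = v^{(q_mb)}(Y mb)]` with coefficients `∏ α_{q_mb}`. [cite: Williams2024, Thm. 8 (proof)] -/
theorem blockEval_eq_sum (X Y : Fin K → Fin k → Bool) : R.blockEval X Y =
    ∑ q : Fin K → Fin r,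
      if ∀ mb, R.left (q mb) (X mb) = R.right (q mb) (Y mb) then R.coefProd q else 0 := by
  unfold blockEval eval coefProd
  rw [Finset.prod_univ_sum, Fintype.piFinset_univ]
  refine Finset.sum_congr rfl fun q _ => ?_
  convert Fintype.prod_ite_zero

/-- The defining vector `U^{(q)}` of the `q`-th equality matrix of the Kronecker power, packed in
base `bound` (Williams, ECCC TR24-142, proof of Thm. 8: "the concatenation of `u^{(q_m)}(i_m)` over
all `m`"). [cite: Williams2024, Thm. 8 (proof)] -/
def key (F : Fin r → (Fin k → Bool) → ℕ) (q : Fin K → Fin r) (X : Fin K → Fin k → Bool) : ℕ :=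
  ∑ mb : Fin K, F (q mb) (X mb) * R.bound ^ (mb : ℕ)

/-- Packed keys agree iff all block values agree (uniqueness of base-`bound` digits). [folklore] -/
theorem key_eq_key_iff (q : Fin K → Fin r) (X Y : Fin K → Fin k → Bool) :
    R.key R.left q X = R.key R.right q Y ↔ ∀ mb, R.left (q mb) (X mb) = R.right (q mb) (Y mb) := by
  let f : Fin K → Fin R.bound := fun mb => ⟨R.left (q mb) (X mb), R.left_lt _ _⟩
  let g : Fin K → Fin R.bound := fun mb => ⟨R.right (q mb) (Y mb), R.right_lt _ _⟩
  have hf : R.key R.left q X = (finFunctionFinEquiv f : ℕ) := by rw [finFunctionFinEquiv_apply]; rfl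
  have hg : R.key R.right q Y = (finFunctionFinEquiv g : ℕ) := by rw [finFunctionFinEquiv_apply]; rfl
  rw [hf, hg, Fin.val_inj, Equiv.apply_eq_iff_eq, funext_iff]
  simp only [f, g, Fin.mk.injEq]

end blocks

end EqRep

/-! ### Blocks of a vector and the pair sum -/

/-- Block `mb` (of length `k`) of a `d`-bit vector, zero-padded past the end (Williams,
ECCC TR24-142, proof of Thm. 8: "let `d' ≥ d` be the smallest integer that is … divisible by `k`").
Zero padding keeps (non-)orthogonality. [cite: Williams2024, Thm. 8 (proof)] -/
def blockOf (k : ℕ) {d : ℕ} (a : Fin d → Bool) (mb : ℕ) : Fin k → Bool :=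
  fun t => if h : mb * k + t < d then a ⟨mb * k + t, h⟩ else false

/-- `DISJ_d = DISJ_k^{⊗ d/k}`: two vectors are orthogonal iff all their (zero-padded) blocks are
(Williams, ECCC TR24-142, proof of Thm. 8, citing [Alm21]). [cite: Williams2024, Thm. 8 (proof)] -/
theorem areOrthogonal_iff_blocks {k K d : ℕ} (hk : 0 < k) (hd : d ≤ k * K) (a b : Fin d → Bool) :
    AreOrthogonal a b ↔ ∀ mb : Fin K, AreOrthogonal (blockOf k a mb) (blockOf k b mb) := by
  refine ⟨fun h mb t ht => ?_, fun h c hc => ?_⟩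
  · simp only [blockOf] at ht
    by_cases hlt : (mb : ℕ) * k + t < d
    · simp only [hlt, dif_pos] at ht; exact h _ ht
    · simp [hlt] at ht
  · have hmb : (c : ℕ) / k < K := Nat.div_lt_of_lt_mul (lt_of_lt_of_le c.2 hd)
    have ht : (c : ℕ) % k < k := Nat.mod_lt _ hk
    have hc' : (c : ℕ) / k * k + (c : ℕ) % k = c := Nat.div_add_mod' c k
    refine h ⟨_, hmb⟩ ⟨_, ht⟩ ?_
    have hlt : (c : ℕ) / k * k + (c : ℕ) % k < d := by rw [hc']; exact c.2
    simp only [blockOf, hlt, dif_pos]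
    have : (⟨(c : ℕ) / k * k + (c : ℕ) % k, hlt⟩ : Fin d) = c := Fin.ext hc'
    rw [this]; exact hc

namespace EqRep

variable {k r : ℕ} (R : EqRep k r) (K : ℕ) {n d : ℕ}

/-- The `K` blocks of length `k` of a vector, as a family. [cite: Williams2024, Thm. 8 (proof)] -/
def blocks (k K : ℕ) {d : ℕ} (a : Fin d → Bool) : Fin K → Fin k → Bool := fun mb => blockOf k a mb

/-- **The pair sum `S`** of two lists of `n` vectors (Williams, ECCC TR24-142, proof of Thm. 10,
with the square taken blockwise before the Kronecker power): the sum over all `n²` pairs of the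
Kronecker-power entries. [cite: Williams2024, Thm. 10 (proof)] -/
def pairSum (A B : Fin n → Fin d → Bool) : ℤ :=
  ∑ i, ∑ j, R.blockEval (blocks k K (A i)) (blocks k K (B j))

/-- The pair sum of a positive representation is nonnegative. [cite: Williams2024, Thm. 10 (proof)] -/
theorem pairSum_nonneg (hR : R.IsPosDisj) (A B : Fin n → Fin d → Bool) : 0 ≤ R.pairSum K A B :=
  Finset.sum_nonneg fun _ _ => Finset.sum_nonneg fun _ _ => R.blockEval_nonneg hR _ _

/-- **`S > 0` iff there is an orthogonal pair** ("if there is no satisfying pair then `S' = 0`, and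
if there is a satisfying pair then `S' > 0`", Williams, ECCC TR24-142, proof of Thm. 10), when the
`K` blocks of length `k ≥ 1` cover all `d ≤ kK` coordinates. [cite: Williams2024, Thm. 10 (proof)] -/
theorem pairSum_pos_iff (hR : R.IsPosDisj) (hk : 0 < k) (hd : d ≤ k * K)
    (A B : Fin n → Fin d → Bool) :
    0 < R.pairSum K A B ↔ ∃ i j, AreOrthogonal (A i) (B j) := by
  unfold pairSum
  rw [Finset.sum_pos_iff_of_nonneg (s := univ)
    (f := fun i => ∑ j, R.blockEval (blocks k K (A i)) (blocks k K (B j)))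
    fun _ _ => Finset.sum_nonneg fun _ _ => R.blockEval_nonneg hR _ _]
  simp only [mem_univ, true_and]
  refine exists_congr fun i => ?_
  rw [Finset.sum_pos_iff_of_nonneg (s := univ)
    (f := fun j => R.blockEval (blocks k K (A i)) (blocks k K (B j)))
    fun _ _ => R.blockEval_nonneg hR _ _]
  simp only [mem_univ, true_and]
  refine exists_congr fun j => ?_
  rw [R.blockEval_pos_iff hR, areOrthogonal_iff_blocks hk hd]
  rfl

/-- **Counting form of the pair sum**: `S = Σ_q (∏ α_{q_mb}) · #{(i,j) : U^{(q)}[a_i] = V^{(q)}[b_j]}`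
— the rearrangement "`S = Σ_k α_k · T_k`" with the double sums `T_k` of Williams, ECCC TR24-142,
proofs of Thms. 9 and 10, each `T_k` being a count of equal keys. [cite: Williams2024, Thm. 10 (proof)] -/
theorem pairSum_eq_count (A B : Fin n → Fin d → Bool) : R.pairSum K A B =
    ∑ q : Fin K → Fin r, R.coefProd q *
      ((univ ×ˢ univ).filter fun p : Fin n × Fin n =>
        R.key R.left q (blocks k K (A p.1)) = R.key R.right q (blocks k K (B p.2))).card := by
  unfold pairSum
  simp only [R.blockEval_eq_sum]
  rw [← Finset.sum_product' (f := fun i j => ∑ q : Fin K → Fin r,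
    if ∀ mb, R.left (q mb) (blocks k K (A i) mb) = R.right (q mb) (blocks k K (B j) mb)
      then R.coefProd q else 0), Finset.sum_comm]
  refine Finset.sum_congr rfl fun q _ => ?_
  rw [← Finset.sum_filter, Finset.sum_const, nsmul_eq_mul, mul_comm]
  congr 2
  exact congrArg Finset.card (Finset.filter_congr fun (p : Fin n × Fin n) _ =>
    (R.key_eq_key_iff q (blocks k K (A p.1)) (blocks k K (B p.2))).symm)

end EqRep

end Literature.Computability.FineGrained
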